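import Mathlib
import HarnessLib
import Literature.Analysis.FluidPDE.ClassicalSolution
import Literature.Analysis.FluidPDE.ClassicalSolutionRescale
import Literature.Analysis.FluidPDE.ClassicalSolutionCalculus
import Literature.Analysis.FluidPDE.WholeSpaceIBP
import Literature.Analysis.FunctionSpaces.SobolevDomain
import Literature.Analysis.FunctionSpaces.TorusTestFunction

/-!
# Stub `stub_testedRescaledNS` of the line `Sketch` (crux stmt-AnomalousDissipation-19035,
# `PointSink.SolitonTransplant`): the tested identities of the exact NS rescalings of a soliton

Registered signature (proved here, textually; `E³ = EuclideanSpace ℝ (Fin 3)`, `𝕋³ = UnitAddTorus (Fin 3)`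
are the skeleton's local notations, redeclared below):
```
theorem stub_testedRescaledNS :
    ∀ (Q : E³ → E³) (P : E³ → ℝ),
      IsClassicalNSSolutionOn Set.univ 1 (fun _ _ => 0) (fun _ => Q) (fun _ => P) →
      ∀ μ : ℝ, 0 < μ →
        (∀ φ : E³ → E³, ContDiff ℝ ∞ φ → HasCompactSupport φ →
          (∀ x, VectorCalculus.divergence φ x = 0) →
          ∫ x, ⟪μ ^ (2 / 3 : ℝ) • Q (μ • x), fderiv ℝ φ x (μ ^ (2 / 3 : ℝ) • Q (μ • x))⟫_ℝ =
            -(μ ^ (-(1 / 3 : ℝ))) * ∫ x, ⟪μ ^ (2 / 3 : ℝ) • Q (μ • x), (Δ φ) x⟫_ℝ) ∧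
        (∀ θ : E³ → ℝ, ContDiff ℝ ∞ θ → HasCompactSupport θ →
          ∫ x, ⟪μ ^ (2 / 3 : ℝ) • Q (μ • x), gradient θ x⟫_ℝ = 0)
```
Proof. (1) `IsClassicalNSSolutionOn.stRescale` (`ClassicalSolutionRescale`) with `α = μ^{2/3}`, `γ = μ`,
`β = αγ`, `t₀ = 0`, `x₀ = 0` turns the steady unit-viscosity zero-force classical solution `(Q, P)` on `ℝ³`
into the steady zero-force classical solution `u = μ^{2/3} Q(μ·)`, `p = μ^{4/3} P(μ·)` at viscosity
`μ^{2/3} · 1 / μ = μ^{-1/3}` (`Real.rpow_sub`). (2) For ANY steady classical zero-force solution `(u, p)` at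
viscosity `ν` on the whole space, the slice identity
`IsClassicalNSSolutionOn.integral_inner_timeDerivWithin_test` (`ClassicalSolutionCalculus`; Leray 1934, (17):
the pressure drops out against divergence-free tests, the convective and viscous terms are moved onto the
test field by the whole-space integrations by parts of `WholeSpaceIBP`) has vanishing left-hand side (the
time line of a time-constant field is constant, `derivWithin_fun_const`), whence
`∫ ⟪u, Dφ·u⟫ = −ν ∫ ⟪u, Δφ⟫`; and `∫ ⟪u, ∇θ⟫ = 0` is `integral_mul_divergence_add_eq_zero_left`
(`WholeSpaceIBP`) with `div u = 0`. Pure proof file (no definitions). [folklore]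
-/

-- `Summit.<Summit>.<Problem>` is the tree's mandated summit-side namespace (CONVENTIONS §2); for this
-- single-conjunct summit the two coincide, so the duplicate is deliberate.
set_option linter.dupNamespace false

noncomputable section

namespace Summit.AnomalousDissipation.AnomalousDissipation.Theorems

open MeasureTheory Filter Topology Set Metric
open scoped InnerProductSpace ContDiff Laplacian
open Literature.Analysis.FunctionSpaces Literature.Analysis.FluidPDE

/-- Physical space `ℝ³` (local notation, as in the registered skeleton). -/
local notation "E³" => EuclideanSpace ℝ (Fin 3)
/-- The flat three-torus (local notation, as in the registered skeleton). -/
local notation "𝕋³" => UnitAddTorus (Fin 3)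

/-! ### Tested identities of a steady classical zero-force Navier–Stokes solution on the whole space -/

section Steady

open Function

variable {E : Type*} [NormedAddCommGroup E] [InnerProductSpace ℝ E] [FiniteDimensional ℝ E]
  [MeasurableSpace E] [BorelSpace E]

/-- **Tested momentum equation of a steady classical solution.** For a steady classical solution `(u, p)`
of the zero-force Navier–Stokes system at viscosity `ν` on the whole space and a smooth compactly
supported divergence-free test field `φ`: `∫ ⟪u, Dφ·u⟫ = −ν ∫ ⟪u, Δφ⟫` — the slice identity
`IsClassicalNSSolutionOn.integral_inner_timeDerivWithin_test` at `t = 0`, whose left-hand side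
`∫ ⟪∂ₜu, φ⟫` vanishes for a time-constant field (Leray 1934, (17)). [folklore] -/
private theorem integral_inner_fderiv_apply_eq_of_steady {ν : ℝ} {u : E → E} {p : E → ℝ}
    (h : IsClassicalNSSolutionOn (Set.univ : Set ℝ) ν (fun (_ : ℝ) (_ : E) => (0 : E))
      (fun _ => u) (fun _ => p))
    {φ : E → E} (hφ : ContDiff ℝ ∞ φ) (hc : HasCompactSupport φ)
    (hdiv : ∀ x, VectorCalculus.divergence φ x = 0) :
    ∫ x, ⟪u x, fderiv ℝ φ x (u x)⟫_ℝ = -ν * ∫ x, ⟪u x, (Δ φ) x⟫_ℝ := by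
  have hφ2 : ContDiff ℝ 2 φ := contDiff_infty.1 hφ 2
  have hφ1 : ContDiff ℝ 1 φ := contDiff_infty.1 hφ 1
  have huc : Continuous u := (h.contDiff_velocity (Set.mem_univ (0 : ℝ))).continuous
  have key := h.integral_inner_timeDerivWithin_test uniqueDiffOn_univ (Set.mem_univ (0 : ℝ)) hφ2 hc
    hdiv
  -- the time derivative of the time-constant field vanishes, and so does the force
  have h0 : ∀ x, timeDerivWithin (Set.univ : Set ℝ) (fun _ : ℝ => u) 0 x = 0 := fun x => by
    simp [timeDerivWithin_apply]
  simp only [h0, inner_zero_left, integral_zero, add_zero] at key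
  -- split the right-hand side
  have iC : Integrable (fun x => ⟪u x, convect u φ x⟫_ℝ) (volume : Measure E) :=
    integrable_inner_of_hasCompactSupport_right huc
      ((hφ1.continuous_fderiv one_ne_zero).clm_apply huc)
      ((hc.fderiv (𝕜 := ℝ)).mono fun x hx => by
        contrapose! hx; simp only [mem_support, not_not] at hx; simp [convect, hx])
  have iL : Integrable (fun x => ⟪u x, (Δ φ) x⟫_ℝ) (volume : Measure E) :=
    integrable_inner_of_hasCompactSupport_right huc (continuous_laplacian hφ2)
      (hc.mono' fun x hx => by
        contrapose! hx; simp [laplacian_eq_zero_of_notMem_tsupport hx])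
  rw [integral_add iC (iL.const_mul ν), integral_const_mul] at key
  simp only [convect_apply] at key
  linarith

/-- **A steady classical solution is weakly divergence free.** For a steady classical solution `u`
(`C¹`, `div u = 0`) and a smooth compactly supported scalar `θ`: `∫ ⟪u, ∇θ⟫ = 0`
(`integral_mul_divergence_add_eq_zero_left`, Leray 1934, §6 (1.11)). [folklore] -/
private theorem integral_inner_gradient_eq_zero_of_steady {ν : ℝ} {u : E → E} {p : E → ℝ}
    (h : IsClassicalNSSolutionOn (Set.univ : Set ℝ) ν (fun (_ : ℝ) (_ : E) => (0 : E))
      (fun _ => u) (fun _ => p))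
    {θ : E → ℝ} (hθ : ContDiff ℝ ∞ θ) (hc : HasCompactSupport θ) :
    ∫ x, ⟪u x, gradient θ x⟫_ℝ = 0 := by
  have hu1 : ContDiff ℝ 1 u := contDiff_infty.1 (h.contDiff_velocity (Set.mem_univ (0 : ℝ))) 1
  have hθ1 : ContDiff ℝ 1 θ := contDiff_infty.1 hθ 1
  have hdiv : ∀ x, VectorCalculus.divergence u x = 0 := h.divFree 0 (Set.mem_univ (0 : ℝ))
  have key := integral_mul_divergence_add_eq_zero_left hθ1 hu1 hc
  simpa [hdiv] using key

end Steady

/-- **S3 `stub_testedRescaledNS`.** For a smooth steady solution `(Q, P)` of unit-viscosity unforced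
Navier–Stokes on `ℝ³` and `μ > 0`, the rescaling `u(x) = μ^{2/3} Q(μ x)`, `p(x) = μ^{4/3} P(μ x)` is a
smooth steady solution at viscosity `μ^{-1/3}` with zero force (`IsClassicalNSSolutionOn.stRescale` with
`α = μ^{2/3}`, `γ = μ`), hence satisfies the TESTED identities `∫ ⟪u, Dφ·u⟫ = −μ^{-1/3} ∫ ⟪u, Δφ⟫` for
every smooth compactly supported divergence-free `φ` and `∫ ⟪u, ∇θ⟫ = 0` for every smooth compactly
supported `θ` (Leray 1934, (17) and §6 (1.11), via `IsClassicalNSSolutionOn.integral_inner_timeDerivWithin_test`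
and `integral_mul_divergence_add_eq_zero_left`). [folklore] -/
theorem stub_testedRescaledNS :
    ∀ (Q : E³ → E³) (P : E³ → ℝ),
      IsClassicalNSSolutionOn Set.univ 1 (fun _ _ => 0) (fun _ => Q) (fun _ => P) →
      ∀ μ : ℝ, 0 < μ →
        (∀ φ : E³ → E³, ContDiff ℝ ∞ φ → HasCompactSupport φ →
          (∀ x, VectorCalculus.divergence φ x = 0) →
          ∫ x, ⟪μ ^ (2 / 3 : ℝ) • Q (μ • x), fderiv ℝ φ x (μ ^ (2 / 3 : ℝ) • Q (μ • x))⟫_ℝ =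
            -(μ ^ (-(1 / 3 : ℝ))) * ∫ x, ⟪μ ^ (2 / 3 : ℝ) • Q (μ • x), (Δ φ) x⟫_ℝ) ∧
        (∀ θ : E³ → ℝ, ContDiff ℝ ∞ θ → HasCompactSupport θ →
          ∫ x, ⟪μ ^ (2 / 3 : ℝ) • Q (μ • x), gradient θ x⟫_ℝ = 0) := by
  intro Q P hNS μ hμ
  -- the exact NS rescaling `α = μ^{2/3}`, `γ = μ`, `β = αγ`, centred at the space–time origin
  have hα : 0 < μ ^ (2 / 3 : ℝ) := Real.rpow_pos_of_pos hμ _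
  have key := hNS.stRescale hα hμ rfl 0 0
  have hν : μ ^ (2 / 3 : ℝ) * 1 / μ = μ ^ (-(1 / 3 : ℝ)) := by
    rw [mul_one, show (-(1 / 3 : ℝ)) = 2 / 3 - 1 by norm_num, Real.rpow_sub hμ, Real.rpow_one]
  have hf : (((μ ^ (2 / 3 : ℝ)) ^ 2 * μ) • stPull (μ ^ (2 / 3 : ℝ) * μ) μ 0 (0 : E³)
      (fun (_ : ℝ) (_ : E³) => (0 : E³))) = fun _ _ => 0 := by
    funext t x
    simp [stPull_apply]
  have hu : ((μ ^ (2 / 3 : ℝ)) • stPull (μ ^ (2 / 3 : ℝ) * μ) μ 0 (0 : E³) (fun _ : ℝ => Q)) =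
      fun _ x => μ ^ (2 / 3 : ℝ) • Q (μ • x) := by
    funext t x
    simp [stPull_apply]
  have hp : ((μ ^ (2 / 3 : ℝ)) ^ 2 • stPull (μ ^ (2 / 3 : ℝ) * μ) μ 0 (0 : E³) (fun _ : ℝ => P)) =
      fun _ x => (μ ^ (2 / 3 : ℝ)) ^ 2 • P (μ • x) := by
    funext t x
    simp [stPull_apply]
  rw [Set.preimage_univ, hν, hf, hu, hp] at key
  exact ⟨fun φ hφ hc hdiv => integral_inner_fderiv_apply_eq_of_steady key hφ hc hdiv,
    fun θ hθ hc => integral_inner_gradient_eq_zero_of_steady key hθ hc⟩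

end Summit.AnomalousDissipation.AnomalousDissipation.Theorems

end
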